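import Summits.ResolutionOfSingularities.ResolutionOfSingularities.Theses.IndSmooth
import Literature.AlgebraicGeometry.Resolution.ArithmeticalThreefolds
import Literature.AlgebraicGeometry.Resolution.SmoothImpliesRegular
import Mathlib.RingTheory.Smooth.Locus
import Mathlib.Algebra.Polynomial.Inductions
import HarnessLib

/-!
# Injective charts uniformize: the crux `IndSmooth.SmoothToUniformizing` with INJECTIVE smooth charts
# (stmt-ResolutionOfSingularities-16088, line `birth`, sub-goals `stub_lurelAt_of_injectiveCharts`,
# `stub_chart_injective_of_isAlgebraic`)

Route `ResolutionOfSingularities/IndSmooth`, crux #3 `SmoothToUniformizing` — the INJECTIVITY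
UPGRADE: "every finitely generated `R ⊆ O` factors `R → T → O` through a smooth `k`-algebra `T`
(a smooth CHART of `R` into the valuation ring `O`), for all valuation rings of all function fields
over all perfect fields of characteristic `p`" ⇒ "relative local uniformization at `p`" (a finitely
generated `A` with `R ≤ A ⊆ O`, `Frac A = K`, `A` regular at the centre `𝔪_O ∩ A`: a MODEL).

This file makes precise, kernel-checked, the slogan that **the whole content of the crux is to make
the charts injective**:

* `stub_lurelAt_of_injectiveCharts` — if the charts `χ : T → K` can be taken INJECTIVE, relative
  local uniformization follows at once: enlarge `R` by an affine model of `K` inside `O`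
  (`exists_affineModel`), take an injective smooth chart `T` of the enlarged algebra, and let
  `A := χ(T) ≅ T`; `A` is finitely generated, contains `R`, has fraction field `K`, and is smooth
  over `k`, hence regular at every prime (EGA IV 17.5.8 (iii), the tree's
  `isRegularLocalRing_of_isSmoothAt`), in particular at the centre. Consequently
  `smoothToUniformizing_of_injectiveCharts`: the crux with its antecedent strengthened to injective
  charts is TRUE (antecedent of the crux unused).
* `stub_chart_injective_of_isAlgebraic` — the algebraic injectivity criterion behind "injective ⇔
  equidimensional" (idea card `slice-the-chart`, (O1)): a chart `R → T → K` (`χ ∘ ψ =` the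
  inclusion) on a DOMAIN `T` which is ALGEBRAIC over `R` (every element of `T` is a root of a
  non-zero polynomial over `R`; e.g. `dim T = trdeg_k K`) is automatically injective — a kernel
  element's minimal equation has constant term in `R ∩ ker = 0`, so it is divisible by the variable,
  contradicting minimality in the domain `T`.

So a proof of the crux is exactly a procedure lowering the dimension of smooth charts to
`trdeg_k K` (equivalently, killing `ker χ`) while keeping them smooth and landing in `O`; slicing by
a kernel element outside `𝔪_q²` does one step, and the obstruction `ker χ ⊆ 𝔪_q²` is "the image
level is singular at the centre" — local uniformization itself (lead's NOTES, `Lines/birth.md`).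

References: EGA IV₄ 17.5.8 (iii); U. Görtz, T. Wedhorn, *Algebraic Geometry I*, Lemma 6.26.
-/

noncomputable section

-- single-problem summit: the doubled namespace component `ResolutionOfSingularities` is forced
set_option linter.dupNamespace false

open Summit.ResolutionOfSingularities.ResolutionOfSingularities.Theses.IndSmooth (SmoothToUniformizing)
open Literature.AlgebraicGeometry.Resolution (exists_affineModel isFractionRing_of_le centreIdeal
  isRegularLocalRing_of_isSmoothAt)
open IsLocalRing Polynomial

namespace Summit.ResolutionOfSingularities.ResolutionOfSingularities.Theorems.IndSmoothBirth

/-! ## Injective charts give models -/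

section Chart

variable {k K : Type} [Field k] [Field K] [Algebra k K]

/-- A chart bounds `R` from above by the image of `T`. [folklore] -/
theorem le_range_of_chart {R : Subalgebra k K} {T : Type} [CommRing T] [Algebra k T]
    (ψ : R →ₐ[k] T) (χ : T →ₐ[k] K) (h : ∀ r : R, χ (ψ r) = (r : K)) : R ≤ χ.range := by
  intro x hx
  exact ⟨ψ ⟨x, hx⟩, h ⟨x, hx⟩⟩

/-- The image of a chart lands in `O` when the chart does. [folklore] -/
theorem range_toSubring_le_of_chart {T : Type} [CommRing T] [Algebra k T] (O : ValuationSubring K)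
    (χ : T →ₐ[k] K) (hχ : ∀ t : T, χ t ∈ O) : χ.range.toSubring ≤ O.toSubring := by
  rintro x ⟨t, rfl⟩
  exact hχ t

/-- **An injective smooth chart is a model regular at every centre.** If `χ : T → K` is an
injective `k`-algebra map from a smooth `k`-algebra `T` into `K` with image inside the valuation
subring `O`, then the image `A = χ(T)` is finitely generated and its localization at the centre of
`O` is a regular local ring: `A ≅ T` is smooth over the field `k`, hence smooth at every prime, and
smooth-at-a-prime over a field means regular local ring (EGA IV 17.5.8 (iii)).
[cite: GortzWedhorn2020, Lemma 6.26 (p. 196)] -/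
theorem isRegularLocalRing_centre_range_of_injective {T : Type} [CommRing T] [Algebra k T]
    [Algebra.Smooth k T] (O : ValuationSubring K) (χ : T →ₐ[k] K) (hinj : Function.Injective χ)
    (hχ : ∀ t : T, χ t ∈ O) :
    IsRegularLocalRing (Localization.AtPrime
      (Ideal.comap (Subring.inclusion (range_toSubring_le_of_chart O χ hχ))
        (IsLocalRing.maximalIdeal O))) := by
  -- `A = χ(T) ≅ T` is smooth over `k`
  let e : T ≃ₐ[k] χ.range := AlgEquiv.ofInjective χ hinj
  haveI : Algebra.Smooth k χ.range := Algebra.Smooth.of_equiv e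
  -- the centre, as an ideal of the type `↥χ.range`
  let 𝔭 : Ideal χ.range := centreIdeal χ.range O (range_toSubring_le_of_chart O χ hχ)
  haveI : 𝔭.IsPrime := inferInstance
  -- smooth everywhere, in particular at `𝔭`
  haveI : Algebra.IsSmoothAt k 𝔭 := by
    have h : (⟨𝔭, inferInstance⟩ : PrimeSpectrum χ.range) ∈ Algebra.smoothLocus k χ.range := by
      rw [Algebra.smoothLocus_eq_univ]; trivial
    exact h
  exact isRegularLocalRing_of_isSmoothAt k χ.range 𝔭

end Chart

/-- **Registered sub-goal `stub_lurelAt_of_injectiveCharts`: INJECTIVE smooth charts give relative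
local uniformization.** At a prime `p` (in fact for any `p`): if over every perfect field `k` of
characteristic `p`, every finitely generated `k`-subalgebra `R` of a valuation ring `O ⊇ k` of a
finitely generated field `K/k` admits a smooth chart `R → T → O` whose second map `χ : T → K` is
INJECTIVE, then every such `R` lies in a finitely generated `A ⊆ O` with `Frac A = K` which is
regular at the centre of `O`. Proof: enlarge `R` by an affine model `A₀ ⊆ O` of `K`
(`exists_affineModel`), take an injective chart of `R ⊔ A₀`, and use its image
(`isRegularLocalRing_centre_range_of_injective`); `Frac = K` is inherited from `A₀`.
[cite: GortzWedhorn2020, Lemma 6.26 (p. 196)] -/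
theorem stub_lurelAt_of_injectiveCharts (p : ℕ)
    (h : ∀ (k K : Type) [Field k] [CharP k p] [PerfectField k] [Field K] [Algebra k K],
      (⊤ : IntermediateField k K).FG → ∀ O : ValuationSubring K, (∀ c : k, algebraMap k K c ∈ O) →
      ∀ R : Subalgebra k K, R.FG → R.toSubring ≤ O.toSubring →
      ∃ (T : Type) (_ : CommRing T) (_ : Algebra k T), Algebra.Smooth k T ∧
        ∃ (ψ : R →ₐ[k] T) (χ : T →ₐ[k] K), Function.Injective χ ∧ (∀ t : T, χ t ∈ O) ∧
          ∀ r : R, χ (ψ r) = (r : K)) :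
    ∀ (k K : Type) [Field k] [CharP k p] [PerfectField k] [Field K] [Algebra k K],
      (⊤ : IntermediateField k K).FG → ∀ O : ValuationSubring K, (∀ c : k, algebraMap k K c ∈ O) →
      ∀ R : Subalgebra k K, R.FG → R.toSubring ≤ O.toSubring →
      ∃ (A : Subalgebra k K) (h : A.toSubring ≤ O.toSubring), R ≤ A ∧ A.FG ∧ IsFractionRing A K ∧
        IsRegularLocalRing (Localization.AtPrime
          (Ideal.comap (Subring.inclusion h) (IsLocalRing.maximalIdeal O))) := by
  intro k K _ _ _ _ _ hK O hO R hR hRO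
  -- an affine model of `K` inside `O`, joined to `R`
  obtain ⟨A₀, hA₀O, hA₀fg, hA₀fr⟩ := exists_affineModel k K hK O hO
  have hR'O : (R ⊔ A₀).toSubring ≤ O.toSubring := by
    let Oalg : Subalgebra k K := { O.toSubring with algebraMap_mem' := hO }
    change R ⊔ A₀ ≤ Oalg
    exact sup_le (fun x hx => hRO hx) (fun x hx => hA₀O hx)
  have hR'fr : IsFractionRing ↥(R ⊔ A₀) K := isFractionRing_of_le le_sup_right hA₀fr
  -- an injective chart of `R ⊔ A₀`, and its image
  obtain ⟨T, _, _, hT, ψ, χ, hinj, hχ, hψχ⟩ := h k K hK O hO (R ⊔ A₀) (hR.sup hA₀fg) hR'O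
  have hle : R ⊔ A₀ ≤ χ.range := le_range_of_chart ψ χ hψχ
  have hfg : χ.range.FG := by
    haveI : Algebra.FiniteType k T := inferInstance
    rw [← Algebra.map_top]
    exact Subalgebra.FG.map _ Algebra.FiniteType.out
  exact ⟨χ.range, range_toSubring_le_of_chart O χ hχ, le_sup_left.trans hle, hfg,
    isFractionRing_of_le hle hR'fr, isRegularLocalRing_centre_range_of_injective O χ hinj hχ⟩

/-- **The crux with INJECTIVE charts is true.** If at every prime `p` the smooth charts of the
antecedent of `SmoothToUniformizing` can be chosen with `χ : T → K` injective, then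
`SmoothToUniformizing` holds (indeed its conclusion holds outright, the ind-smoothness antecedent
being unused). [folklore] -/
theorem smoothToUniformizing_of_injectiveCharts
    (h : ∀ p : ℕ, p.Prime →
      ∀ (k K : Type) [Field k] [CharP k p] [PerfectField k] [Field K] [Algebra k K],
      (⊤ : IntermediateField k K).FG → ∀ O : ValuationSubring K, (∀ c : k, algebraMap k K c ∈ O) →
      ∀ R : Subalgebra k K, R.FG → R.toSubring ≤ O.toSubring →
      ∃ (T : Type) (_ : CommRing T) (_ : Algebra k T), Algebra.Smooth k T ∧
        ∃ (ψ : R →ₐ[k] T) (χ : T →ₐ[k] K), Function.Injective χ ∧ (∀ t : T, χ t ∈ O) ∧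
          ∀ r : R, χ (ψ r) = (r : K)) :
    SmoothToUniformizing :=
  fun p hp _ => stub_lurelAt_of_injectiveCharts p (h p hp)

/-! ## Algebraic charts are injective -/

/-- **Registered sub-goal `stub_chart_injective_of_isAlgebraic`: a chart on a domain algebraic
over `R` is injective.** Let `R ⊆ K` be a `k`-subalgebra of a field, `T` a domain, `ψ : R → T` and
`χ : T → K` algebra maps with `χ (ψ r) = r`. If every element of `T` is a root of a NON-ZERO
polynomial with coefficients in `R` (read in `T` through `ψ`), then `χ` is injective. Proof: for
`t ∈ ker χ`, a non-zero polynomial `f` of least degree with `f(t) = 0` has constant term `c₀` with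
`c₀ = χ(f(t) - (f - c₀)(t)) = 0` in `K` (apply `χ`, which kills `t`), so `f = X · g` with `g ≠ 0`,
`g(t) · t = 0`, hence `g(t) = 0` in the domain `T` if `t ≠ 0` — contradicting minimality. With
`dim T = trdeg_k K` for a finitely generated domain `T ⊇ R`, `Frac R = K`, the hypothesis holds
(`Frac T` is algebraic over `K`), which is the slogan "equidimensional smooth charts are
injective". [folklore] -/
theorem stub_chart_injective_of_isAlgebraic (k K : Type) [Field k] [Field K] [Algebra k K]
    (R : Subalgebra k K) (T : Type) [CommRing T] [IsDomain T] [Algebra k T] (ψ : R →ₐ[k] T)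
    (χ : T →ₐ[k] K) (hχ : ∀ r : R, χ (ψ r) = (r : K))
    (halg : ∀ t : T, ∃ f : Polynomial R, f ≠ 0 ∧ Polynomial.eval₂ ψ.toRingHom t f = 0) :
    Function.Injective χ := by
  rw [injective_iff_map_eq_zero]
  intro t ht
  by_contra ht0
  -- no non-zero polynomial over `R` kills `t`: induction on the degree
  have key : ∀ n : ℕ, ∀ f : Polynomial R, f.natDegree ≤ n → f ≠ 0 →
      Polynomial.eval₂ ψ.toRingHom t f = 0 → False := by
    intro n
    induction n with
    | zero =>
      intro f hdeg hf0 hf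
      -- `f = C c` with `ψ c = 0`, so `c = χ (ψ c) = 0` in `K`, so `f = 0`
      obtain ⟨c, rfl⟩ : ∃ c, f = C c := ⟨f.coeff 0, Polynomial.eq_C_of_natDegree_le_zero hdeg⟩
      rw [Polynomial.eval₂_C] at hf
      have hc : (c : K) = 0 := by rw [← hχ c]; change χ (ψ.toRingHom c) = 0; rw [hf, map_zero]
      exact hf0 (by rw [show c = 0 from Subtype.ext hc, map_zero])
    | succ n ih =>
      intro f hdeg hf0 hf
      -- split off the constant term: `f = divX f * X + C c₀`
      have hsplit : f.divX * X + C (f.coeff 0) = f := Polynomial.divX_mul_X_add f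
      have hev : Polynomial.eval₂ ψ.toRingHom t (f.divX * X + C (f.coeff 0)) = 0 := by
        rw [hsplit]; exact hf
      rw [Polynomial.eval₂_add, Polynomial.eval₂_mul, Polynomial.eval₂_X, Polynomial.eval₂_C]
        at hev
      -- applying `χ` (which kills `t`) shows `c₀ = 0`
      have hc0 : f.coeff 0 = 0 := by
        have e := congrArg χ hev
        rw [map_add, map_mul, ht, mul_zero, zero_add, map_zero] at e
        have e' : ((f.coeff 0 : R) : K) = 0 := by rw [← hχ (f.coeff 0)]; exact e
        exact Subtype.ext e'
      rw [hc0, map_zero, add_zero] at hev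
      -- so `divX f` kills `t` too (domain), is non-zero and of smaller degree
      have hev' : Polynomial.eval₂ ψ.toRingHom t f.divX = 0 :=
        (mul_eq_zero.mp hev).resolve_right ht0
      have hdivX0 : f.divX ≠ 0 := by
        intro h0
        apply hf0
        rw [← hsplit, h0, zero_mul, zero_add, hc0, map_zero]
      have hdeg' : f.divX.natDegree ≤ n := by
        have h1 : f.divX.natDegree = f.natDegree - 1 := Polynomial.natDegree_divX_eq_natDegree_tsub_one
        omega
      exact ih f.divX hdeg' hdivX0 hev'
  obtain ⟨f, hf0, hf⟩ := halg t
  exact key f.natDegree f le_rfl hf0 hf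

end Summit.ResolutionOfSingularities.ResolutionOfSingularities.Theorems.IndSmoothBirth

end
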